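import Summits.AtomisticToContinuum.HydrodynamicLimit.Theorems.ImplosionDichotomyPolynomialCompressionUniquenessPrimitive

/-!
# Torus jets 0: smoothness closure and first-order rules for `Torus.partialDeriv` on `𝕋³`

Helper file for the line `log-lipschitz-budget` of the crux `ImplosionDichotomy.PolynomialCompression`
(stmt-AtomisticToContinuum-12587), stub `stub_logBudgetShadowing`, levels 2–3 of the `H³` energy
method. There the forcing is `∂ₘ` (resp. `∂ₙ∂ₘ`) of an explicit level-1 function built from
products, quotients and compositions `ζ ∘ ρ` of smooth fields on `𝕋³`; instead of expanding these
derivatives symbolically they are bounded POINTWISE through jet bounds (files `…TorusJetBounds`,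
`…TorusJetBoundsComp`), whose engine is a generic, Euler-free calculus for `Torus.partialDeriv` on
`T3 = UnitAddTorus (Fin 3)`. This first file provides

* smoothness closure `torusJet_isSmooth_*` (const/add/sub/neg/const_mul/sum/mul/comp/inv/div/rpow,
  coordinates of `V3`-valued fields) — all fields downstream are `Torus.IsSmooth`;
* the bridge `torusJet_apply_coord_deriv1/2/3`: `∂ᵢ(y ↦ u y j) = (∂ᵢu) j` up to order 3;
* the engine: derivatives along coordinate lines `torusJet_hasDerivAt_coordLine(_comp)`,
  `torusJet_partialDeriv_eq_of_hasDerivAt`, the passage `ContDiffOn ℝ ⊤ φ J ⇒ HasDerivAt φ (deriv φ r)`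
  on open `J`, and the explicit second/third derivatives of `r ↦ r⁻¹` and `r ↦ r ^ p`
  (the first ones are Mathlib's `hasDerivAt_inv`, `Real.hasDerivAt_rpow_const`);
* the exact first-order identities `torusJet_<op>_deriv1`, `op ∈ {const, add, sub, neg, const_mul,
  sum, mul, comp (two forms), inv, div, rpow}`.

Conventions (kept in all four jet files): the function under `∂` is always a lambda
(`fun y => f y * g y`, `fun y => φ (f y)`, …) so that the lemmas apply by higher-order pattern
unification at a point; compositions come in two forms, `_of_hasDerivAt` (prescribed derivative
functions `φ₁, φ₂, φ₃` of `φ` on a set `J ⊇ f(𝕋³)`) and the `ContDiffOn ℝ (⊤ : ℕ∞) φ J`, `IsOpen J`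
form of `ShadowSetting` (with `deriv φ`, `deriv (deriv φ)`, `deriv (deriv (deriv φ))`).
Proofs: `∂ᵢ` of a `C¹` function is the derivative along the `i`-th coordinate line
(`hasDerivAt_coordLine`, `partialDeriv_eq_of_hasDerivAt` of `…UniquenessPrimitive`) and Mathlib's
one-variable `HasDerivAt` rules.
-/

noncomputable section

namespace Summit.AtomisticToContinuum.HydrodynamicLimit.Theorems

open Set Filter Topology MeasureTheory
open scoped ContDiff
open Literature.MathematicalPhysics.KineticTheory Literature.Analysis.FunctionSpaces

section TorusJetCalculus

/-! ### Smoothness closure -/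

/-- Constants are smooth on `𝕋³`. [folklore] -/
theorem torusJet_isSmooth_const : ∀ (c : ℝ), Torus.IsSmooth (fun _ : T3 => c) :=
  fun c => Torus.isSmooth_const c

/-- Sums of smooth functions on `𝕋³` are smooth. [folklore] -/
theorem torusJet_isSmooth_add : ∀ {f g : T3 → ℝ}, Torus.IsSmooth f → Torus.IsSmooth g →
    Torus.IsSmooth (fun y => f y + g y) :=
  fun hf hg => ContDiff.add hf hg

/-- Differences of smooth functions on `𝕋³` are smooth. [folklore] -/
theorem torusJet_isSmooth_sub : ∀ {f g : T3 → ℝ}, Torus.IsSmooth f → Torus.IsSmooth g →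
    Torus.IsSmooth (fun y => f y - g y) :=
  fun hf hg => ContDiff.sub hf hg

/-- Negatives of smooth functions on `𝕋³` are smooth. [folklore] -/
theorem torusJet_isSmooth_neg : ∀ {f : T3 → ℝ}, Torus.IsSmooth f → Torus.IsSmooth (fun y => -f y) :=
  fun hf => ContDiff.neg hf

/-- Constant multiples of smooth functions on `𝕋³` are smooth. [folklore] -/
theorem torusJet_isSmooth_const_mul : ∀ {f : T3 → ℝ}, Torus.IsSmooth f → ∀ (c : ℝ),
    Torus.IsSmooth (fun y => c * f y) :=
  fun hf _ => ContDiff.mul contDiff_const hf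

/-- Finite sums of smooth functions on `𝕋³` are smooth. [folklore] -/
theorem torusJet_isSmooth_sum : ∀ {ι : Type} (s : Finset ι) {h : ι → T3 → ℝ},
    (∀ l ∈ s, Torus.IsSmooth (h l)) → Torus.IsSmooth (fun y => ∑ l ∈ s, h l y) :=
  fun _ _ hh => ContDiff.sum fun l hl => hh l hl

/-- Products of smooth functions on `𝕋³` are smooth. [folklore] -/
theorem torusJet_isSmooth_mul : ∀ {f g : T3 → ℝ}, Torus.IsSmooth f → Torus.IsSmooth g →
    Torus.IsSmooth (fun y => f y * g y) :=
  fun hf hg => ContDiff.mul hf hg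

/-- Compositions `φ ∘ f` of a smooth `f : 𝕋³ → J` with `φ` smooth on the open set `J` are smooth.
[folklore] -/
theorem torusJet_isSmooth_comp : ∀ {φ : ℝ → ℝ} {J : Set ℝ} {f : T3 → ℝ}, IsOpen J →
    ContDiffOn ℝ (⊤ : ℕ∞) φ J → Torus.IsSmooth f → (∀ y, f y ∈ J) →
    Torus.IsSmooth (fun y => φ (f y)) :=
  fun _ hφ hf hJ => hφ.comp_contDiff hf fun v => hJ (Torus.proj v)

/-- Inverses of nowhere-vanishing smooth functions on `𝕋³` are smooth. [folklore] -/
theorem torusJet_isSmooth_inv : ∀ {f : T3 → ℝ}, Torus.IsSmooth f → (∀ y, f y ≠ 0) →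
    Torus.IsSmooth (fun y => (f y)⁻¹) :=
  fun hf h0 => ContDiff.inv hf fun v => h0 (Torus.proj v)

/-- Quotients of smooth functions on `𝕋³` by nowhere-vanishing ones are smooth. [folklore] -/
theorem torusJet_isSmooth_div : ∀ {f g : T3 → ℝ}, Torus.IsSmooth f → Torus.IsSmooth g →
    (∀ y, g y ≠ 0) → Torus.IsSmooth (fun y => f y / g y) :=
  fun hf hg h0 => ContDiff.div hf hg fun v => h0 (Torus.proj v)

/-- Real powers of positive smooth functions on `𝕋³` are smooth. [folklore] -/
theorem torusJet_isSmooth_rpow : ∀ {f : T3 → ℝ}, Torus.IsSmooth f → (∀ y, 0 < f y) → ∀ (p : ℝ),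
    Torus.IsSmooth (fun y => f y ^ p) :=
  fun hf hpos _ => ContDiff.rpow_const_of_ne hf fun v => (hpos (Torus.proj v)).ne'

/-- Coordinates of smooth vector fields on `𝕋³` are smooth. [folklore] -/
theorem torusJet_isSmooth_apply_coord : ∀ {u : T3 → V3}, Torus.IsSmooth u → ∀ (j : Fin 3),
    Torus.IsSmooth (fun y => u y j) :=
  fun hu j => hu.apply j

/-! ### Coordinates commute with iterated partial derivatives -/

/-- `∂ᵢ(y ↦ u y j) = (∂ᵢu) j` for smooth vector fields. [folklore] -/
theorem torusJet_apply_coord_deriv1 : ∀ {u : T3 → V3}, Torus.IsSmooth u → ∀ (j i : Fin 3) (x : T3),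
    Torus.partialDeriv i (fun y => u y j) x = Torus.partialDeriv i u x j :=
  fun hu j i x => Torus.partialDeriv_apply_coord (hu.isContDiff (by simp)) i x j

/-- `∂ᵢ∂ₖ(y ↦ u y j) = (∂ᵢ∂ₖu) j` for smooth vector fields. [folklore] -/
theorem torusJet_apply_coord_deriv2 : ∀ {u : T3 → V3}, Torus.IsSmooth u → ∀ (j i k : Fin 3) (x : T3),
    Torus.partialDeriv i (Torus.partialDeriv k (fun y => u y j)) x =
      Torus.partialDeriv i (Torus.partialDeriv k u) x j := by
  intro u hu j i k x
  rw [show Torus.partialDeriv k (fun y => u y j) = fun y => Torus.partialDeriv k u y j from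
    funext fun y => torusJet_apply_coord_deriv1 hu j k y]
  exact torusJet_apply_coord_deriv1 (hu.partialDeriv k) j i x

/-- `∂ᵢ∂ₖ∂ₗ(y ↦ u y j) = (∂ᵢ∂ₖ∂ₗu) j` for smooth vector fields. [folklore] -/
theorem torusJet_apply_coord_deriv3 : ∀ {u : T3 → V3}, Torus.IsSmooth u →
    ∀ (j i k l : Fin 3) (x : T3),
    Torus.partialDeriv i (Torus.partialDeriv k (Torus.partialDeriv l (fun y => u y j))) x =
      Torus.partialDeriv i (Torus.partialDeriv k (Torus.partialDeriv l u)) x j := by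
  intro u hu j i k l x
  rw [show Torus.partialDeriv l (fun y => u y j) = fun y => Torus.partialDeriv l u y j from
    funext fun y => torusJet_apply_coord_deriv1 hu j l y]
  exact torusJet_apply_coord_deriv2 (hu.partialDeriv l) j i k x

/-! ### Engine: derivatives along coordinate lines, one-variable jets of `r⁻¹` and `r ^ p` -/

/-- A smooth function along the `i`-th coordinate line through `x` has derivative `∂ᵢf(x)` at
parameter `0`. [folklore] -/
theorem torusJet_hasDerivAt_coordLine {f : T3 → ℝ} (hf : Torus.IsSmooth f) (x : T3) (i : Fin 3) :
    HasDerivAt (fun s : ℝ => f (x + Torus.proj (s • EuclideanSpace.single i (1 : ℝ))))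
      (Torus.partialDeriv i f x) 0 :=
  hasDerivAt_coordLine (hf.isContDiff (by simp)) x i

/-- Chain rule along the `i`-th coordinate line: `s ↦ ψ (f (x + s eᵢ))` has derivative
`d ∂ᵢf(x)` at `0` if `ψ` has derivative `d` at `f x`. [folklore] -/
theorem torusJet_hasDerivAt_coordLine_comp {f : T3 → ℝ} (hf : Torus.IsSmooth f) {ψ : ℝ → ℝ}
    {d : ℝ} (x : T3) (i : Fin 3) (hψ : HasDerivAt ψ d (f x)) :
    HasDerivAt (fun s : ℝ => ψ (f (x + Torus.proj (s • EuclideanSpace.single i (1 : ℝ)))))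
      (d * Torus.partialDeriv i f x) 0 :=
  HasDerivAt.comp_of_eq (0 : ℝ) hψ (torusJet_hasDerivAt_coordLine hf x i)
    (by simp only [zero_smul, Torus.proj_zero, add_zero])

/-- Read off `∂ᵢF(x)` from a derivative along the coordinate line, up to rewriting the value.
[folklore] -/
theorem torusJet_partialDeriv_eq_of_hasDerivAt {F : T3 → ℝ} {x : T3} {i : Fin 3} {f' g' : ℝ}
    (h : HasDerivAt (fun s : ℝ => F (x + Torus.proj (s • EuclideanSpace.single i (1 : ℝ)))) f' 0)
    (he : f' = g') : Torus.partialDeriv i F x = g' :=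
  partialDeriv_eq_of_hasDerivAt (h.congr_deriv he)

/-- From `ContDiffOn ℝ ⊤ φ J` on an open `J`: `φ` has derivative `deriv φ r` at every `r ∈ J`.
[folklore] -/
theorem torusJet_hasDerivAt_of_contDiffOn {φ : ℝ → ℝ} {J : Set ℝ} (hJ : IsOpen J)
    (hφ : ContDiffOn ℝ (⊤ : ℕ∞) φ J) : ∀ r ∈ J, HasDerivAt φ (deriv φ r) r :=
  fun _ hr => ((hφ.differentiableOn (by simp)).differentiableAt (hJ.mem_nhds hr)).hasDerivAt

/-- From `ContDiffOn ℝ ⊤ φ J` on an open `J`: `deriv φ` is again `ContDiffOn ℝ ⊤` on `J`.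
[folklore] -/
theorem torusJet_contDiffOn_deriv {φ : ℝ → ℝ} {J : Set ℝ} (hJ : IsOpen J)
    (hφ : ContDiffOn ℝ (⊤ : ℕ∞) φ J) : ContDiffOn ℝ (⊤ : ℕ∞) (deriv φ) J :=
  hφ.deriv_of_isOpen hJ le_rfl

/-- `r ↦ -(r²)⁻¹` (the derivative of `r ↦ r⁻¹`) has derivative `2 (r³)⁻¹` at `r ≠ 0`. [folklore] -/
theorem torusJet_hasDerivAt_invJet2 {r : ℝ} (hr : r ≠ 0) :
    HasDerivAt (fun r : ℝ => -(r ^ 2)⁻¹) (2 * (r ^ 3)⁻¹) r := by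
  refine ((hasDerivAt_pow 2 r).fun_inv (pow_ne_zero 2 hr)).fun_neg.congr_deriv ?_
  have hr2 : r ^ 2 ≠ 0 := pow_ne_zero 2 hr
  have hr3 : r ^ 3 ≠ 0 := pow_ne_zero 3 hr
  rw [div_eq_mul_inv, eq_comm]
  field_simp
  norm_num

/-- `r ↦ 2 (r³)⁻¹` has derivative `-(6 (r⁴)⁻¹)` at `r ≠ 0`. [folklore] -/
theorem torusJet_hasDerivAt_invJet3 {r : ℝ} (hr : r ≠ 0) :
    HasDerivAt (fun r : ℝ => 2 * (r ^ 3)⁻¹) (-(6 * (r ^ 4)⁻¹)) r := by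
  refine (((hasDerivAt_pow 3 r).fun_inv (pow_ne_zero 3 hr)).const_mul 2).congr_deriv ?_
  have hr3 : r ^ 3 ≠ 0 := pow_ne_zero 3 hr
  have hr4 : r ^ 4 ≠ 0 := pow_ne_zero 4 hr
  rw [div_eq_mul_inv, eq_comm]
  field_simp
  norm_num

/-- `r ↦ p r^{p-1}` has derivative `p (p-1) r^{p-2}` at `r > 0`. [folklore] -/
theorem torusJet_hasDerivAt_rpowJet2 (p : ℝ) {r : ℝ} (hr : 0 < r) :
    HasDerivAt (fun r : ℝ => p * r ^ (p - 1)) (p * (p - 1) * r ^ (p - 2)) r := by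
  have h := (Real.hasDerivAt_rpow_const (p := p - 1) (Or.inl hr.ne')).const_mul p
  rw [show p - 1 - 1 = p - 2 by ring] at h
  exact h.congr_deriv (by ring)

/-- `r ↦ p (p-1) r^{p-2}` has derivative `p (p-1) (p-2) r^{p-3}` at `r > 0`. [folklore] -/
theorem torusJet_hasDerivAt_rpowJet3 (p : ℝ) {r : ℝ} (hr : 0 < r) :
    HasDerivAt (fun r : ℝ => p * (p - 1) * r ^ (p - 2)) (p * (p - 1) * (p - 2) * r ^ (p - 3)) r := by
  have h := (Real.hasDerivAt_rpow_const (p := p - 2) (Or.inl hr.ne')).const_mul (p * (p - 1))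
  rw [show p - 2 - 1 = p - 3 by ring] at h
  exact h.congr_deriv (by ring)

/-! ### Order 1 -/

/-- `∂ᵢ c = 0`. [folklore] -/
theorem torusJet_const_deriv1 : ∀ (c : ℝ) (i : Fin 3) (x : T3),
    Torus.partialDeriv i (fun _ : T3 => c) x = 0 :=
  fun c _ _ => partialDeriv_eq_of_hasDerivAt (hasDerivAt_const (0 : ℝ) c)

/-- `∂ᵢ(f + g) = ∂ᵢf + ∂ᵢg`. [folklore] -/
theorem torusJet_add_deriv1 : ∀ {f g : T3 → ℝ}, Torus.IsSmooth f → Torus.IsSmooth g →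
    ∀ (i : Fin 3) (x : T3),
    Torus.partialDeriv i (fun y => f y + g y) x = Torus.partialDeriv i f x + Torus.partialDeriv i g x :=
  fun hf hg i x => partialDeriv_eq_of_hasDerivAt
    ((torusJet_hasDerivAt_coordLine hf x i).fun_add (torusJet_hasDerivAt_coordLine hg x i))

/-- `∂ᵢ(f - g) = ∂ᵢf - ∂ᵢg`. [folklore] -/
theorem torusJet_sub_deriv1 : ∀ {f g : T3 → ℝ}, Torus.IsSmooth f → Torus.IsSmooth g →
    ∀ (i : Fin 3) (x : T3),
    Torus.partialDeriv i (fun y => f y - g y) x = Torus.partialDeriv i f x - Torus.partialDeriv i g x :=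
  fun hf hg i x => partialDeriv_eq_of_hasDerivAt
    ((torusJet_hasDerivAt_coordLine hf x i).fun_sub (torusJet_hasDerivAt_coordLine hg x i))

/-- `∂ᵢ(-f) = -∂ᵢf`. [folklore] -/
theorem torusJet_neg_deriv1 : ∀ {f : T3 → ℝ}, Torus.IsSmooth f → ∀ (i : Fin 3) (x : T3),
    Torus.partialDeriv i (fun y => -f y) x = -Torus.partialDeriv i f x :=
  fun hf i x => partialDeriv_eq_of_hasDerivAt (torusJet_hasDerivAt_coordLine hf x i).fun_neg

/-- `∂ᵢ(c f) = c ∂ᵢf`. [folklore] -/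
theorem torusJet_const_mul_deriv1 : ∀ {f : T3 → ℝ}, Torus.IsSmooth f → ∀ (c : ℝ) (i : Fin 3) (x : T3),
    Torus.partialDeriv i (fun y => c * f y) x = c * Torus.partialDeriv i f x :=
  fun hf c i x => partialDeriv_eq_of_hasDerivAt ((torusJet_hasDerivAt_coordLine hf x i).const_mul c)

/-- `∂ᵢ(∑ₗ hₗ) = ∑ₗ ∂ᵢhₗ` (finite sums). [folklore] -/
theorem torusJet_sum_deriv1 : ∀ {ι : Type} (s : Finset ι) {h : ι → T3 → ℝ},
    (∀ l ∈ s, Torus.IsSmooth (h l)) → ∀ (i : Fin 3) (x : T3),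
    Torus.partialDeriv i (fun y => ∑ l ∈ s, h l y) x = ∑ l ∈ s, Torus.partialDeriv i (h l) x :=
  fun _ _ hh i x => partialDeriv_eq_of_hasDerivAt
    (HasDerivAt.fun_sum fun l hl => torusJet_hasDerivAt_coordLine (hh l hl) x i)

/-- **Leibniz rule, order 1**: `∂ᵢ(f g) = ∂ᵢf g + f ∂ᵢg`. [folklore] -/
theorem torusJet_mul_deriv1 : ∀ {f g : T3 → ℝ}, Torus.IsSmooth f → Torus.IsSmooth g →
    ∀ (i : Fin 3) (x : T3),
    Torus.partialDeriv i (fun y => f y * g y) x =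
      Torus.partialDeriv i f x * g x + f x * Torus.partialDeriv i g x :=
  fun hf hg i x => torusJet_partialDeriv_eq_of_hasDerivAt
    ((torusJet_hasDerivAt_coordLine hf x i).fun_mul (torusJet_hasDerivAt_coordLine hg x i))
    (by simp only [zero_smul, Torus.proj_zero, add_zero])

/-- **Chain rule, order 1** (prescribed derivative `φ₁` of `φ` on `J ⊇ f(𝕋³)`):
`∂ᵢ(φ ∘ f) = φ₁(f) ∂ᵢf`. [folklore] -/
theorem torusJet_comp_deriv1_of_hasDerivAt : ∀ {φ φ₁ : ℝ → ℝ} {J : Set ℝ} {f : T3 → ℝ},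
    Torus.IsSmooth f → (∀ y, f y ∈ J) → (∀ r ∈ J, HasDerivAt φ (φ₁ r) r) →
    ∀ (i : Fin 3) (x : T3),
    Torus.partialDeriv i (fun y => φ (f y)) x = φ₁ (f x) * Torus.partialDeriv i f x :=
  fun hf hJ hφ i x => partialDeriv_eq_of_hasDerivAt
    (torusJet_hasDerivAt_coordLine_comp hf x i (hφ _ (hJ x)))

/-- **Chain rule, order 1** (`φ` smooth on the open `J ⊇ f(𝕋³)`): `∂ᵢ(φ ∘ f) = φ'(f) ∂ᵢf` with
`φ' = deriv φ`. [folklore] -/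
theorem torusJet_comp_deriv1 : ∀ {φ : ℝ → ℝ} {J : Set ℝ} {f : T3 → ℝ}, IsOpen J →
    ContDiffOn ℝ (⊤ : ℕ∞) φ J → Torus.IsSmooth f → (∀ y, f y ∈ J) → ∀ (i : Fin 3) (x : T3),
    Torus.partialDeriv i (fun y => φ (f y)) x = deriv φ (f x) * Torus.partialDeriv i f x :=
  fun hJ hφ hf hfJ i x =>
    torusJet_comp_deriv1_of_hasDerivAt hf hfJ (torusJet_hasDerivAt_of_contDiffOn hJ hφ) i x

/-- `∂ᵢ(1/f) = -∂ᵢf / f²` (`f ≠ 0`). [folklore] -/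
theorem torusJet_inv_deriv1 : ∀ {f : T3 → ℝ}, Torus.IsSmooth f → (∀ y, f y ≠ 0) →
    ∀ (i : Fin 3) (x : T3),
    Torus.partialDeriv i (fun y => (f y)⁻¹) x = -Torus.partialDeriv i f x / f x ^ 2 :=
  fun hf h0 i x => torusJet_partialDeriv_eq_of_hasDerivAt
    ((torusJet_hasDerivAt_coordLine hf x i).fun_inv (h0 _))
    (by simp only [zero_smul, Torus.proj_zero, add_zero])

/-- Quotient rule `∂ᵢ(f/g) = (∂ᵢf g - f ∂ᵢg) / g²` (`g ≠ 0`). [folklore] -/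
theorem torusJet_div_deriv1 : ∀ {f g : T3 → ℝ}, Torus.IsSmooth f → Torus.IsSmooth g →
    (∀ y, g y ≠ 0) → ∀ (i : Fin 3) (x : T3),
    Torus.partialDeriv i (fun y => f y / g y) x =
      (Torus.partialDeriv i f x * g x - f x * Torus.partialDeriv i g x) / g x ^ 2 :=
  fun hf hg h0 i x => torusJet_partialDeriv_eq_of_hasDerivAt
    ((torusJet_hasDerivAt_coordLine hf x i).fun_div (torusJet_hasDerivAt_coordLine hg x i) (h0 _))
    (by simp only [zero_smul, Torus.proj_zero, add_zero])

/-- `∂ᵢ(f ^ p) = p f^{p-1} ∂ᵢf` (`f > 0`, real exponent). [folklore] -/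
theorem torusJet_rpow_deriv1 : ∀ {f : T3 → ℝ}, Torus.IsSmooth f → (∀ y, 0 < f y) →
    ∀ (p : ℝ) (i : Fin 3) (x : T3),
    Torus.partialDeriv i (fun y => f y ^ p) x = p * f x ^ (p - 1) * Torus.partialDeriv i f x :=
  fun hf hpos _ i x => torusJet_comp_deriv1_of_hasDerivAt (J := Ioi 0) hf hpos
    (fun _ hr => Real.hasDerivAt_rpow_const (Or.inl (ne_of_gt hr))) i x

end TorusJetCalculus

end Summit.AtomisticToContinuum.HydrodynamicLimit.Theorems

end
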